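import Literature.AlgebraicGeometry.Motives.GaloisThickening
import HarnessLib

/-!
# The absolute Galois group on the sheets of a Galois thickening: `σ̃ · (P, e) = (σ̃ P, σ̃ ∘ e)`, and on each sheet
# «sheet change ∘ σ̃» is `σ̃` on the underlying `K`-scheme ([GortzWedhorn2020] (4.8)–(4.9), (14.20); [Milne2017] Prop. 3.1)

Topic `Literature/AlgebraicGeometry/Motives`, namespace `Literature.AlgebraicGeometry.Motives`.  THEOREMS only (no def,
no instance, no notation, no named fact, no `sorry`).  Cell `hodgecm-mathlib`, programme P6 («MOD»), organ (d3) = «GAL-6»,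
the sequel of ★ `GaloisThickening` (organ GAL: `thickening K L`, `thickeningπ`, `thickeningGalAction`, the sections
`thickeningLift e`, `thickeningPointsEquiv : (R_L X)(Ω) ≃ X(Ω) × Hom_K(L, Ω)`) needed under the FROB-SHEET conjunct of the
P6a heart letter (`FrobeniusSheet θ Fr₀ := ∀ p, ∃ γ, Fr₀ p = θ(γ,1)_s (F̃ p)`, desk F0P6a-plan ED. 2 (ii)).

## Mathematics

Let `K ⊆ L` be fields, `X` a `K`-scheme, `R_L X = (X ⊗_K L → Spec L → Spec K)` its Galois thickening, `Ω` a field over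
`K`.  The `Ω`-points of `R_L X` over `K` are the pairs `(P, e)` of an `Ω`-point `P` of `X` and a `K`-embedding
`e : L → Ω` (★ `thickeningPointsEquiv`; the point is `ℓ_e P = (P, Spec e)`), and `Gal(L/K)` acts through ★
`thickeningGalAction` by `γ · (P, e) = (P, e ∘ γ⁻¹)` (★ `map_aut_thickeningLift`).  The group `Aut(Ω/K)` acts on
`Ω`-points of every `K`-scheme by the tree's LEFT action `σ̃ • P = Spec σ̃ ≫ P` (★ `AlgPoints.smul_def`).  This file
proves:

* **§1 `Aut(Ω/K)` moves the sheets**: `σ̃ • ℓ_e P = ℓ_{σ̃ ∘ e} (σ̃ • P)` (`smul_thickeningLift`); hence the embedding of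
  `σ̃ • Q` is `σ̃ ∘ e_Q` (`embOfPoint_smul`) and in the pair description `σ̃ · (P, e) = (σ̃ • P, σ̃ ∘ e)`
  (`thickeningPointsEquiv_smul`).
* **§2 On each sheet, «sheet change ∘ `σ̃`» is `σ̃` on `X`**: if `σ̃ ∘ e = e ∘ γ` for some `γ ∈ Gal(L/K)` (the restriction
  of `σ̃` to `L` READ THROUGH the sheet `e`; it exists whenever `L/K` is normal, `exists_algEquiv_comp_eq_comp`, and is
  unique, `algEquiv_comp_eq_comp_unique`), then `γ · (σ̃ • ℓ_e P) = ℓ_e (σ̃ • P)` (`map_aut_smul_thickeningLift`),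
  equivalently `σ̃ • ℓ_e P = γ⁻¹ · ℓ_e (σ̃ • P)`; packaged for `L/K` normal as `exists_map_aut_smul_thickeningLift`.

USE (P6a FROB-SHEET).  For a place `w`, `Ω = \overline{F_w}` and `σ̃` an arithmetic Frobenius, ★
`IntegralModel.geomReductionMap_smul_of_isAbsArithFrob` gives `F̃ (red y) = red (σ̃ • y)` on `Ω`-points `y` of the
generic fibre of a proper model; with `y = ℓ_e P` and §2, `θ(γ_e, 1)_s (F̃ (red (ℓ_e P))) = red (ℓ_e (σ̃ • P))` once the
model action `θ` extends the Galois action and reduction is `θ`-equivariant — the `∃ γ` of `FrobeniusSheet`, with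
`γ_e = e⁻¹ σ̃ e` in the decomposition group; and by (d1)+(d2) (★ `AbelianSchemeFibreFrobeniusTwist(Hom)`) the moduli
tuple at the moved point of the sheet is the Frobenius twist of the tuple.  HC_CM is proved only modulo the printed
citations until rung 0 closes; this file changes no count.

## References
* [GortzWedhorn2020] U. Görtz, T. Wedhorn, *Algebraic Geometry I* (2nd ed.), §(4.8)–(4.9) (points with values in a field,
  base change), (14.20) (Galois descent data ∕ twists).
* [Milne2017] J. S. Milne, *Algebraic Groups*, CUP 2017, Prop. 3.1 ∕ A.59 (the `Aut(Ω/k)`-action on `X(Ω)` and Weil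
  restriction on points).
* [Milne2005ShimuraVarieties] J. S. Milne, *Introduction to Shimura varieties*, §11 p. 108 («`σP ∈ σV(Ω)`»).
-/

set_option autoImplicit false

noncomputable section

-- `(specOver K Ω).left = Spec Ω` is definitional only above `instances` transparency (as in ★ `GaloisThickening`,
-- ★ `AbelianSchemeFibreFrobeniusTwist`).
set_option backward.isDefEq.respectTransparency false

open CategoryTheory AlgebraicGeometry Limits

universe u

namespace Literature.AlgebraicGeometry.Motives

open Literature.AlgebraicGeometry.RelativeSpec
open Literature.AlgebraicGeometry.Motives.AbelianVariety (bcSpec specMap_algEquiv_comp_bcSpec)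

variable {K L : Type u} [Field K] [Field L] [Algebra K L] {Ω : Type u} [Field Ω] [Algebra K Ω]

/-! ## §1 `Aut(Ω/K)` moves the sheets: `σ̃ · (P, e) = (σ̃ P, σ̃ ∘ e)` -/

section Smul

variable (σ : Ω ≃ₐ[K] Ω) (e : L →ₐ[K] Ω)

/-- `Spec (σ̃ ∘ e) = Spec σ̃ ≫ Spec e` (contravariance of `Spec`). [cite: GortzWedhorn2020, §(4.8)–(4.9)] -/
theorem specMap_ofHom_algEquiv_comp :
    Spec.map (CommRingCat.ofHom (((σ : Ω →ₐ[K] Ω).comp e : L →ₐ[K] Ω) : L →+* Ω)) =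
      Spec.map (CommRingCat.ofHom (σ : Ω →+* Ω)) ≫ Spec.map (CommRingCat.ofHom (e : L →+* Ω)) := by
  rw [← Spec.map_comp, ← CommRingCat.ofHom_comp]
  rfl

/-- **`Aut(Ω/K)` moves the sheets: `σ̃ • ℓ_e P = ℓ_{σ̃ ∘ e} (σ̃ • P)`** — the absolute automorphism `σ̃` of `Ω` over
`K` carries the point `(P, Spec e)` of the thickening to `(σ̃ • P, Spec (σ̃ ∘ e))` (tree's LEFT action
`σ̃ • P = Spec σ̃ ≫ P`, ★ `AlgPoints.smul_def`). [cite: GortzWedhorn2020, §(4.8)–(4.9)] [cite: Milne2017, Prop. 3.1] -/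
theorem smul_thickeningLift (X : SchemeOver K) (P : AlgPoints X Ω) :
    σ • thickeningLift e X P = thickeningLift ((σ : Ω →ₐ[K] Ω).comp e) X (σ • P) := by
  apply Over.OverMorphism.ext
  rw [AlgPoints.smul_left, thickeningLift_left, thickeningLift_left]
  apply pullback.hom_ext
  · rw [Category.assoc, pullback.lift_fst, pullback.lift_fst, AlgPoints.smul_left]
  · rw [Category.assoc, pullback.lift_snd, pullback.lift_snd, specMap_ofHom_algEquiv_comp]

/-- The projection is equivariant: `π_X (σ̃ • Q) = σ̃ • π_X Q` (★ `AlgPoints.map_smul`). [cite: GortzWedhorn2020, §(4.8)–(4.9)] -/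
theorem map_thickeningπ_smul (X : SchemeOver K) (Q : AlgPoints ((thickening K L).obj X) Ω) :
    AlgPoints.map (thickeningπ X) (σ • Q) = σ • AlgPoints.map (thickeningπ X) Q :=
  AlgPoints.map_smul _ σ Q

/-- **The sheet of `σ̃ • Q` is `σ̃ ∘ (sheet of Q)`**: `e_{σ̃ • Q} = σ̃ ∘ e_Q` for the `K`-embedding `e_Q : L → Ω` attached to
an `Ω`-point `Q` of the thickening (★ `AlgPoints.embOfPoint`). [cite: GortzWedhorn2020, §(4.8)–(4.9)] [cite: Milne2017, Prop. 3.1] -/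
theorem embOfPoint_smul (X : SchemeOver K) (Q : AlgPoints ((thickening K L).obj X) Ω) :
    AlgPoints.embOfPoint ((baseChange K L).obj X) (σ • Q) =
      (σ : Ω →ₐ[K] Ω).comp (AlgPoints.embOfPoint ((baseChange K L).obj X) Q) := by
  conv_lhs => rw [← thickeningLift_embOfPoint_map_thickeningπ X Q, smul_thickeningLift]
  exact embOfPoint_thickeningLift _ X _

/-- **In the pair description, `σ̃ · (P, e) = (σ̃ • P, σ̃ ∘ e)`** (★ `thickeningPointsEquiv : (R_L X)(Ω) ≃ X(Ω) × Hom_K(L, Ω)`).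
[cite: GortzWedhorn2020, §(4.8)–(4.9)] [cite: Milne2017, Prop. 3.1] -/
theorem thickeningPointsEquiv_smul (X : SchemeOver K) (Q : AlgPoints ((thickening K L).obj X) Ω) :
    thickeningPointsEquiv X (σ • Q) =
      (σ • (thickeningPointsEquiv X Q).1, (σ : Ω →ₐ[K] Ω).comp (thickeningPointsEquiv X Q).2) := by
  rw [thickeningPointsEquiv_apply, thickeningPointsEquiv_apply, map_thickeningπ_smul, embOfPoint_smul]

/-- The inverse pair description: `σ̃ • (P, e)⁻¹-image`, i.e. `σ̃ • (thickeningPointsEquiv X).symm (P, e) =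
(thickeningPointsEquiv X).symm (σ̃ • P, σ̃ ∘ e)`. [cite: GortzWedhorn2020, §(4.8)–(4.9)] -/
theorem smul_thickeningPointsEquiv_symm (X : SchemeOver K) (q : AlgPoints X Ω × (L →ₐ[K] Ω)) :
    σ • (thickeningPointsEquiv X).symm q = (thickeningPointsEquiv X).symm (σ • q.1, (σ : Ω →ₐ[K] Ω).comp q.2) := by
  rw [thickeningPointsEquiv_symm_apply, thickeningPointsEquiv_symm_apply, smul_thickeningLift]

end Smul

/-! ## §2 On each sheet, «sheet change ∘ `σ̃`» is `σ̃` on the underlying `K`-scheme -/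

section Sheet

variable (σ : Ω ≃ₐ[K] Ω) (e : L →ₐ[K] Ω)

/-- `(e ∘ γ) ∘ γ⁻¹ = e`. [cite: GortzWedhorn2020, (14.20)] -/
theorem comp_algEquiv_comp_symm (γ : L ≃ₐ[K] L) :
    (e.comp (γ : L →ₐ[K] L)).comp (γ.symm : L →ₐ[K] L) = e := by
  ext x
  simp

/-- **On the sheet `e`, the sheet change `γ` undoes the motion of the sheet by `σ̃`**: if `σ̃ ∘ e = e ∘ γ` (`γ` = the
restriction of `σ̃` to `L` read through `e`), then `γ · (σ̃ • ℓ_e P) = ℓ_e (σ̃ • P)` — the composite «sheet change ∘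
absolute automorphism» acts on the sheet `e ≅ X(Ω)` as `σ̃` does on `X(Ω)` (★ `map_aut_thickeningLift`:
`γ · ℓ_{e'} P = ℓ_{e' ∘ γ⁻¹} P`). [cite: GortzWedhorn2020, (14.20)] [cite: Milne2017, Prop. 3.1] -/
theorem map_aut_smul_thickeningLift (γ : L ≃ₐ[K] L) (hγ : (σ : Ω →ₐ[K] Ω).comp e = e.comp (γ : L →ₐ[K] L))
    (X : SchemeOver K) (P : AlgPoints X Ω) :
    AlgPoints.map (Over.homMk ((thickeningGalAction X).aut γ).hom ((thickeningGalAction X).aut_comp γ))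
        (σ • thickeningLift e X P) =
      thickeningLift e X (σ • P) := by
  rw [smul_thickeningLift, hγ, map_aut_thickeningLift, comp_algEquiv_comp_symm]

/-- The same, solved for `σ̃ • ℓ_e P`: `σ̃ • ℓ_e P = γ⁻¹ · ℓ_e (σ̃ • P)`. [cite: GortzWedhorn2020, (14.20)] -/
theorem smul_thickeningLift_eq_map_aut_symm (γ : L ≃ₐ[K] L) (hγ : (σ : Ω →ₐ[K] Ω).comp e = e.comp (γ : L →ₐ[K] L))
    (X : SchemeOver K) (P : AlgPoints X Ω) :
    σ • thickeningLift e X P =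
      AlgPoints.map (Over.homMk ((thickeningGalAction X).aut γ.symm).hom ((thickeningGalAction X).aut_comp γ.symm))
        (thickeningLift e X (σ • P)) := by
  rw [smul_thickeningLift, hγ, map_aut_thickeningLift]
  rfl

/-- **Existence of the sheet reading of `σ̃`** for `L/K` normal: there is `γ ∈ Gal(L/K)` with `σ̃ ∘ e = e ∘ γ` (Mathlib
`AlgEquiv.restrictNormal` for the `L`-algebra structure on `Ω` given by `e`; `γ = e⁻¹ σ̃ e` lies in the decomposition
group of the sheet when `σ̃` fixes a place). [cite: GortzWedhorn2020, (14.20)] -/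
theorem exists_algEquiv_comp_eq_comp [Normal K L] :
    ∃ γ : L ≃ₐ[K] L, (σ : Ω →ₐ[K] Ω).comp e = e.comp (γ : L →ₐ[K] L) := by
  letI : Algebra L Ω := (e : L →+* Ω).toAlgebra
  haveI : IsScalarTower K L Ω := IsScalarTower.of_algebraMap_eq fun x => (e.commutes x).symm
  refine ⟨σ.restrictNormal L, ?_⟩
  ext x
  exact (σ.restrictNormal_commutes L x).symm

/-- **Uniqueness of the sheet reading**: `γ` with `σ̃ ∘ e = e ∘ γ` is unique (`e` is injective). [cite: GortzWedhorn2020, (14.20)] -/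
theorem algEquiv_comp_eq_comp_unique {γ γ' : L ≃ₐ[K] L} (hγ : (σ : Ω →ₐ[K] Ω).comp e = e.comp (γ : L →ₐ[K] L))
    (hγ' : (σ : Ω →ₐ[K] Ω).comp e = e.comp (γ' : L →ₐ[K] L)) : γ = γ' := by
  ext x
  have h := congrArg (fun φ : L →ₐ[K] Ω => φ x) (hγ.symm.trans hγ')
  exact (e : L →+* Ω).injective h

/-- **FROB-SHEET core, packaged for `L/K` normal**: for every `σ̃ ∈ Aut(Ω/K)` and every sheet `e` there is `γ ∈ Gal(L/K)`
(namely `e⁻¹ σ̃ e`) with `γ · (σ̃ • ℓ_e P) = ℓ_e (σ̃ • P)` for all `Ω`-points `P` of `X` — on the sheet `e`, «sheet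
change `γ` ∘ `σ̃`» is `σ̃` on `X(Ω)`. [cite: GortzWedhorn2020, (14.20)] [cite: Milne2017, Prop. 3.1] -/
theorem exists_map_aut_smul_thickeningLift [Normal K L] (X : SchemeOver K) :
    ∃ γ : L ≃ₐ[K] L, (σ : Ω →ₐ[K] Ω).comp e = e.comp (γ : L →ₐ[K] L) ∧
      ∀ P : AlgPoints X Ω,
        AlgPoints.map (Over.homMk ((thickeningGalAction X).aut γ).hom ((thickeningGalAction X).aut_comp γ))
            (σ • thickeningLift e X P) =
          thickeningLift e X (σ • P) := by
  obtain ⟨γ, hγ⟩ := exists_algEquiv_comp_eq_comp σ e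
  exact ⟨γ, hγ, fun P => map_aut_smul_thickeningLift σ e γ hγ X P⟩

/-- **Change of sheet**: if `σ̃ ∘ e = e ∘ γ` then on the sheet `e ∘ δ` the reading is the conjugate `δ⁻¹ γ δ`:
`σ̃ ∘ (e ∘ δ) = (e ∘ δ) ∘ (δ⁻¹ γ δ)`. [cite: GortzWedhorn2020, (14.20)] -/
theorem algEquiv_comp_comp_eq_of_comp_eq (γ δ : L ≃ₐ[K] L) (hγ : (σ : Ω →ₐ[K] Ω).comp e = e.comp (γ : L →ₐ[K] L)) :
    (σ : Ω →ₐ[K] Ω).comp (e.comp (δ : L →ₐ[K] L)) =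
      (e.comp (δ : L →ₐ[K] L)).comp ((δ.trans (γ.trans δ.symm) : L ≃ₐ[K] L) : L →ₐ[K] L) := by
  ext x
  have h := congrArg (fun φ : L →ₐ[K] Ω => φ (δ x)) hγ
  simpa using h

end Sheet

end Literature.AlgebraicGeometry.Motives

end
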